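import Mathlib

/-!
# Crux `NewtonUnitEquations.DissociatedUniform` (stmt-ValiantsHypothesis-5905), line `greedy-basis-shadow` —
# stub `stub_goodProduct` (Lemma Z: the good product)

Abstract multilinear algebra, no frame language.  Let `S` be a finite set of terms; term `i` is the rank-one
function `b ↦ x i * ∏ j, v i j (b j)` on the box `Fintype.piFinset U`, with `x i ≠ 0` and every factor `v i j`
a function on `U j` that does not vanish identically (zeros ARE allowed).  If the sum of the terms equals `c ≠ 0`
times the indicator of a word `a` of the box, then some term `i ∈ S` is ALIVE at `a` (`v i j (a j) ≠ 0` for every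
coordinate `j`) and has a letter other than `a j` alive in at most `|S| - 1` coordinates `j`.

Proof (elimination induction on `|S|`, formalised below as `stub_goodProduct`).
* If no term has an alive letter other than `a j` in any coordinate, evaluate the equation at `b := a`: the sum is
  `c ≠ 0`, so some term has a nonvanishing product at `a`, i.e. is alive at `a`; its set of coordinates carrying
  another alive letter is empty.
* Otherwise pick a term alive at some `(j, l)` with `l ≠ a j`.  The SLICE `b j := l` of the equation
  (`GoodProduct.slice`) reads `∑_{i ∈ S} x i * v i j l * ∏_{j' ≠ j} v i j' (b j') = 0`.  Choose `i₀ ∈ S` with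
  `v i₀ j l ≠ 0`, dead at `(j, a j)` if some term alive at `(j, l)` is dead there.  Replace the `j`-th factor of
  every term by `v' i j := v i₀ j l • v i j - v i j l • v i₀ j` (so the `j`-th factor of `i₀` dies), erase `i₀`
  and discard the terms whose new `j`-th factor vanishes on `U j`.  By the slice equation the new system sums to
  `v i₀ j l * c` times the indicator of `a` (`GoodProduct.sum_modified`), and it has fewer terms; the induction
  hypothesis returns a good term `i ≠ i₀`, which is still alive at `(j, a j)` for the ORIGINAL factor by the
  choice of `i₀`, and whose depth grows by at most one (coordinate `j`).
[folklore]
-/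

open scoped BigOperators

-- Sub = Summit single-conjunct layout: the duplicated namespace component is mandated by the tree.
set_option linter.dupNamespace false

namespace Summit.ValiantsHypothesis.ValiantsHypothesis.Theorems.NewtonUnitEquationsDissociatedUniform

namespace GoodProduct

variable {ι L : Type} [Fintype ι] [DecidableEq ι]

/-- Splitting off the `j`-th factor of a product over all coordinates:
`∏ j', g j' = g j * ∏_{j' ≠ j} g j'`. [folklore] -/
theorem prod_split (g : ι → ℂ) (j : ι) :
    ∏ j', g j' = g j * ∏ j' ∈ Finset.univ.erase j, g j' :=
  (Finset.mul_prod_erase Finset.univ g (Finset.mem_univ j)).symm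

/-- The product of the factors of a term whose `j`-th factor was replaced (`w' j' = w j'` for `j' ≠ j`),
evaluated at a word `b`: the new `j`-th factor times the old product over `j' ≠ j`. [folklore] -/
theorem prod_replace (w w' : ι → L → ℂ) (j : ι) (hne : ∀ j', j' ≠ j → w' j' = w j') (b : ι → L) :
    ∏ j', w' j' (b j') = w' j (b j) * ∏ j' ∈ Finset.univ.erase j, w j' (b j') := by
  rw [prod_split (fun j' => w' j' (b j')) j]
  congr 1
  exact Finset.prod_congr rfl fun j' hj' => by rw [hne j' (Finset.ne_of_mem_erase hj')]

/-- The product of the factors of a term evaluated at the word `b` with its `j`-th letter replaced by `l`: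
`∏ j', w j' (update b j l j') = w j l * ∏_{j' ≠ j} w j' (b j')`. [folklore] -/
theorem prod_update_arg (w : ι → L → ℂ) (j : ι) (l : L) (b : ι → L) :
    ∏ j', w j' (Function.update b j l j') = w j l * ∏ j' ∈ Finset.univ.erase j, w j' (b j') := by
  rw [prod_split (fun j' => w j' (Function.update b j l j')) j, Function.update_self]
  congr 1
  exact Finset.prod_congr rfl fun j' hj' => by rw [Function.update_of_ne (Finset.ne_of_mem_erase hj')]

/-- **Slice equation.**  If `∑_{i ∈ S} x i * ∏ j, v i j (b j)` is `c` times the indicator of the word `a` on the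
box `piFinset U`, then for a letter `l ∈ U j` with `l ≠ a j` and every box word `b`, the slice `b j := l` gives
`∑_{i ∈ S} x i * (v i j l * ∏_{j' ≠ j} v i j' (b j')) = 0`. [folklore] -/
theorem slice [DecidableEq L] {k : ℕ} (S : Finset (Fin k)) (U : ι → Finset L) (a : ι → L)
    (x : Fin k → ℂ) (v : Fin k → ι → L → ℂ) (c : ℂ)
    (heq : ∀ b ∈ Fintype.piFinset U, ∑ i ∈ S, x i * ∏ j, v i j (b j) = if b = a then c else 0)
    (j : ι) (l : L) (hl : l ∈ U j) (hla : l ≠ a j) (b : ι → L) (hb : b ∈ Fintype.piFinset U) :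
    ∑ i ∈ S, x i * (v i j l * ∏ j' ∈ Finset.univ.erase j, v i j' (b j')) = 0 := by
  have hb' : Function.update b j l ∈ Fintype.piFinset U := by
    rw [Fintype.mem_piFinset] at hb ⊢
    intro j'
    by_cases h : j' = j
    · subst h
      rw [Function.update_self]
      exact hl
    · rw [Function.update_of_ne h]
      exact hb j'
  have hne : Function.update b j l ≠ a := by
    intro h
    apply hla
    have h' := congrFun h j
    rwa [Function.update_self] at h'
  have h := heq _ hb'
  rw [if_neg hne] at h
  rw [← h]
  refine Finset.sum_congr rfl fun i _ => ?_
  rw [prod_update_arg (v i) j l b]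

/-- **Substitution identity.**  Let `i₀ ∈ S`, and let `v'` be `v` with the `j`-th factor of every term replaced by
`v' i j l' = v i₀ j l * v i j l' - v i j l * v i₀ j l'` (other factors unchanged).  If the slice sum
`∑_{i ∈ S} x i * (v i j l * ∏_{j' ≠ j} v i j' (b j'))` vanishes at a word `b` with `b j ∈ U j`, then the modified
system — `i₀` erased and the terms whose new `j`-th factor vanishes on `U j` discarded — sums at `b` to `v i₀ j l`
times the original sum. [folklore] -/
theorem sum_modified {k : ℕ} (S : Finset (Fin k)) (U : ι → Finset L) (x : Fin k → ℂ)
    (v : Fin k → ι → L → ℂ) (j : ι) (l : L) (i₀ : Fin k) (hi₀ : i₀ ∈ S) (v' : Fin k → ι → L → ℂ)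
    (hv'j : ∀ i l', v' i j l' = v i₀ j l * v i j l' - v i j l * v i₀ j l')
    (hv'ne : ∀ i j', j' ≠ j → v' i j' = v i j') (b : ι → L) (hbj : b j ∈ U j)
    (hslice : ∑ i ∈ S, x i * (v i j l * ∏ j' ∈ Finset.univ.erase j, v i j' (b j')) = 0) :
    ∑ i ∈ (S.erase i₀).filter (fun i => ∃ l' ∈ U j, v' i j l' ≠ 0), x i * ∏ j', v' i j' (b j') =
      v i₀ j l * ∑ i ∈ S, x i * ∏ j', v i j' (b j') := by
  -- the discarded terms vanish at `b`
  have hfilt : ∀ i ∈ S.erase i₀, x i * ∏ j', v' i j' (b j') ≠ 0 → ∃ l' ∈ U j, v' i j l' ≠ 0 := by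
    intro i _ hne
    refine ⟨b j, hbj, fun h0 => hne ?_⟩
    rw [prod_replace (v i) (v' i) j (hv'ne i) b, h0, zero_mul, mul_zero]
  rw [Finset.sum_filter_of_ne hfilt]
  -- termwise expansion of the new product
  have key : ∀ i, x i * ∏ j', v' i j' (b j') =
      v i₀ j l * (x i * ∏ j', v i j' (b j')) -
        v i₀ j (b j) * (x i * (v i j l * ∏ j' ∈ Finset.univ.erase j, v i j' (b j'))) := by
    intro i
    rw [prod_replace (v i) (v' i) j (hv'ne i) b, hv'j, prod_split (fun j' => v i j' (b j')) j]
    ring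
  have h1 := Finset.sum_erase_add S (fun i => x i * ∏ j', v i j' (b j')) hi₀
  have h2 := Finset.sum_erase_add S
    (fun i => x i * (v i j l * ∏ j' ∈ Finset.univ.erase j, v i j' (b j'))) hi₀
  rw [hslice] at h2
  have h3 : x i₀ * ∏ j', v i₀ j' (b j') =
      x i₀ * (v i₀ j (b j) * ∏ j' ∈ Finset.univ.erase j, v i₀ j' (b j')) := by
    rw [prod_split (fun j' => v i₀ j' (b j')) j]
  calc ∑ i ∈ S.erase i₀, x i * ∏ j', v' i j' (b j')
      = ∑ i ∈ S.erase i₀, (v i₀ j l * (x i * ∏ j', v i j' (b j')) -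
          v i₀ j (b j) * (x i * (v i j l * ∏ j' ∈ Finset.univ.erase j, v i j' (b j')))) :=
        Finset.sum_congr rfl fun i _ => key i
    _ = v i₀ j l * ∑ i ∈ S.erase i₀, x i * ∏ j', v i j' (b j') -
          v i₀ j (b j) * ∑ i ∈ S.erase i₀, x i * (v i j l * ∏ j' ∈ Finset.univ.erase j, v i j' (b j')) := by
        rw [Finset.sum_sub_distrib, Finset.mul_sum, Finset.mul_sum]
    _ = v i₀ j l * ∑ i ∈ S, x i * ∏ j', v i j' (b j') := by
        linear_combination (v i₀ j l) * h1 - (v i₀ j (b j)) * h2 - (v i₀ j l) * h3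

end GoodProduct

/-- **Lemma Z (good product)** — registered stub `stub_goodProduct` of line `greedy-basis-shadow`.
Let `S` be a finite set of terms, term `i` being the rank-one function `b ↦ x i * ∏ j, v i j (b j)` on the box
`piFinset U` with `x i ≠ 0` and every factor `v i j` not identically zero on `U j`.  If the sum of the terms is
`c ≠ 0` times the indicator of the box word `a`, then some term `i ∈ S` is alive at `a` (`v i j (a j) ≠ 0` for all
`j`) and has a letter other than `a j` alive in at most `|S| - 1` coordinates.  Proof: elimination induction on
`|S|` through the slice equation `GoodProduct.slice` and the substitution identity `GoodProduct.sum_modified`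
(see the module docstring). [folklore] -/
theorem stub_goodProduct {ι L : Type} [Fintype ι] [DecidableEq ι] [DecidableEq L] (k : ℕ)
    (S : Finset (Fin k)) (U : ι → Finset L) (a : ι → L) (ha : ∀ j, a j ∈ U j)
    (x : Fin k → ℂ) (v : Fin k → ι → L → ℂ) (c : ℂ) (hc : c ≠ 0)
    (hx : ∀ i ∈ S, x i ≠ 0) (hv : ∀ i ∈ S, ∀ j, ∃ l ∈ U j, v i j l ≠ 0)
    (heq : ∀ b ∈ Fintype.piFinset U, ∑ i ∈ S, x i * ∏ j, v i j (b j) = if b = a then c else 0) :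
    ∃ i ∈ S, (∀ j, v i j (a j) ≠ 0) ∧
      (Finset.univ.filter fun j => ∃ l ∈ U j, l ≠ a j ∧ v i j l ≠ 0).card + 1 ≤ S.card := by
  obtain ⟨n, hn⟩ : ∃ n, S.card = n := ⟨_, rfl⟩
  induction n using Nat.strong_induction_on generalizing S v c with
  | _ n ih =>
    by_cases hA : ∀ i ∈ S, ∀ j, ∀ l ∈ U j, l ≠ a j → v i j l = 0
    · -- Case A: no term has an alive letter other than `a j`; evaluate at `b := a`.
      have h := heq a (Fintype.mem_piFinset.mpr ha)
      rw [if_pos rfl] at h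
      have hsum : ∑ i ∈ S, x i * ∏ j, v i j (a j) ≠ 0 := by
        rw [h]
        exact hc
      obtain ⟨i, hi, hne⟩ := Finset.exists_ne_zero_of_sum_ne_zero hsum
      have hprod : ∏ j, v i j (a j) ≠ 0 := right_ne_zero_of_mul hne
      refine ⟨i, hi, fun j => Finset.prod_ne_zero_iff.mp hprod j (Finset.mem_univ j), ?_⟩
      have hempty : (Finset.univ.filter fun j => ∃ l ∈ U j, l ≠ a j ∧ v i j l ≠ 0) = ∅ := by
        refine Finset.filter_eq_empty_iff.mpr ?_
        rintro j - ⟨l, hl, hla, hvl⟩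
        exact hvl (hA i hi j l hl hla)
      rw [hempty, Finset.card_empty, zero_add]
      exact Finset.card_pos.mpr ⟨i, hi⟩
    · -- Case B: some term `iS` is alive at `(j, l)` with `l ≠ a j`.
      push Not at hA
      obtain ⟨iS, hiS, j, l, hl, hla, hvl⟩ := hA
      -- the eliminated term `i₀`: alive at `(j, l)`, dead at `(j, a j)` if some term alive at `(j, l)` is
      obtain ⟨i₀, hi₀S, hi₀l, hchoice⟩ : ∃ i₀ ∈ S, v i₀ j l ≠ 0 ∧
          (v i₀ j (a j) ≠ 0 → ∀ i ∈ S, v i j l ≠ 0 → v i j (a j) ≠ 0) := by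
        by_cases hP : ∃ i ∈ S, v i j l ≠ 0 ∧ v i j (a j) = 0
        · obtain ⟨i₀, h1, h2, h3⟩ := hP
          exact ⟨i₀, h1, h2, fun h => absurd h3 h⟩
        · push Not at hP
          exact ⟨iS, hiS, hvl, fun _ i hi hil => hP i hi hil⟩
      -- the modified factors
      obtain ⟨v', hv'j, hv'ne⟩ : ∃ v' : Fin k → ι → L → ℂ,
          (∀ i l', v' i j l' = v i₀ j l * v i j l' - v i j l * v i₀ j l') ∧
            (∀ i j', j' ≠ j → v' i j' = v i j') :=
        ⟨fun i => Function.update (v i) j (fun l' => v i₀ j l * v i j l' - v i j l * v i₀ j l'),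
          fun i l' => by simp only [Function.update_self], fun i j' h => by simp only [Function.update_of_ne h]⟩
      -- the modified set of terms
      obtain ⟨S', hS'⟩ : ∃ S' : Finset (Fin k), S' = (S.erase i₀).filter (fun i => ∃ l' ∈ U j, v' i j l' ≠ 0) :=
        ⟨_, rfl⟩
      have hS'sub : S' ⊆ S.erase i₀ := hS' ▸ Finset.filter_subset _ _
      have hS'S : ∀ i ∈ S', i ∈ S := fun i hi => (Finset.mem_erase.mp (hS'sub hi)).2
      have hcard : S'.card + 1 ≤ S.card := by
        have h1 := Finset.card_le_card hS'sub
        rw [Finset.card_erase_of_mem hi₀S] at h1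
        have hpos : 0 < S.card := Finset.card_pos.mpr ⟨i₀, hi₀S⟩
        omega
      have hx' : ∀ i ∈ S', x i ≠ 0 := fun i hi => hx i (hS'S i hi)
      have hvS' : ∀ i ∈ S', ∀ j', ∃ l' ∈ U j', v' i j' l' ≠ 0 := by
        intro i hi j'
        by_cases hj' : j' = j
        · rw [hj']
          rw [hS', Finset.mem_filter] at hi
          exact hi.2
        · rw [hv'ne i j' hj']
          exact hv i (hS'S i hi) j'
      have heq' : ∀ b ∈ Fintype.piFinset U,
          ∑ i ∈ S', x i * ∏ j', v' i j' (b j') = if b = a then v i₀ j l * c else 0 := by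
        intro b hb
        rw [hS', GoodProduct.sum_modified S U x v j l i₀ hi₀S v' hv'j hv'ne b (Fintype.mem_piFinset.mp hb j)
          (GoodProduct.slice S U a x v c heq j l hl hla b hb), heq b hb, mul_ite, mul_zero]
      have hdc : v i₀ j l * c ≠ 0 := mul_ne_zero hi₀l hc
      -- induction hypothesis for the modified system
      obtain ⟨i, hiS', halive, hdepth⟩ :=
        ih S'.card (by omega) S' v' (v i₀ j l * c) hdc hx' hvS' heq' rfl
      have hiS : i ∈ S := hS'S i hiS'
      -- translate back to the original factors
      have halive_v : ∀ j', v i j' (a j') ≠ 0 := by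
        intro j'
        by_cases hj' : j' = j
        · rw [hj']
          intro hzero
          have h1 := halive j
          rw [hv'j, hzero, mul_zero, zero_sub, neg_ne_zero, mul_ne_zero_iff] at h1
          exact hchoice h1.2 i hiS h1.1 hzero
        · rw [← hv'ne i j' hj']
          exact halive j'
      refine ⟨i, hiS, halive_v, ?_⟩
      have hsub : (Finset.univ.filter fun j' => ∃ l' ∈ U j', l' ≠ a j' ∧ v i j' l' ≠ 0) ⊆
          insert j (Finset.univ.filter fun j' => ∃ l' ∈ U j', l' ≠ a j' ∧ v' i j' l' ≠ 0) := by
        intro j' hj'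
        rw [Finset.mem_insert]
        by_cases h : j' = j
        · exact Or.inl h
        · right
          rw [Finset.mem_filter] at hj' ⊢
          rw [hv'ne i j' h]
          exact hj'
      have hle := (Finset.card_le_card hsub).trans (Finset.card_insert_le _ _)
      omega

end Summit.ValiantsHypothesis.ValiantsHypothesis.Theorems.NewtonUnitEquationsDissociatedUniform
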